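import Summits.Ventures.HodgeRepro2.T5BergmanCoefficientLp

/-!
# The integrability and `L^p` thresholds on `H_j = U(1,1)`

The thresholds of `T5BergmanIntegrableSharp` / `T5BergmanCoefficientLp` transferred from `SU(1,1)` to
`U(1,1) = Z · SU(1,1)` through the product map `mulHom : Circle × SU(1,1) → U(1,1)` of `T5U11Product`:
a continuous function on `U(1,1)` whose value at `λ g` depends on `g ∈ SU(1,1)` alone is integrable
against a Haar measure of `U(1,1)` iff its restriction is integrable against a Haar measure of `SU(1,1)`
(`integrable_iff_of_mulHom`: the product formula `map mulHom (haarCircle ⊗ μ_S) = c · μ_U`, `c > 0`, and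
Mathlib's `Integrable.comp_snd_iff` for the probability factor `haarCircle`). Since
`|⟨π_k(λ g) f, h⟩_k| = |⟨π_k(g) f, h⟩_k|` (the central character has modulus one):

* `integrable_matrixCoeffU_lowest_lowest_iff`: `g ↦ ⟨π_k(g) 1, 1⟩_k ∈ L¹(U(1,1), μ_U)` iff `k ≥ 3`;
* `memLp_matrixCoeffU_lowest_lowest_iff`: `∈ L^p(U(1,1), μ_U)` iff `k p > 2`;
* `integrable_matrixCoeffU_partialSum_partialSum` / `memLp_matrixCoeffU_partialSum_partialSum`: every
  `K`-finite matrix coefficient of `π_k` on `U(1,1)` is integrable for `k ≥ 3` and lies in `L^p` for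
  `k p > 2`.

Nothing is claimed about (N). Blind lane: Mathlib + the HodgeRepro2 prefix only; no sorry; axioms ⊆
{propext, Classical.choice, Quot.sound}.
-/

namespace Summit.Ventures.HodgeRepro2.T5BergmanIntegrableSharpU11

open MeasureTheory MeasureTheory.Measure Metric Filter Topology Set Finset
open T5PoincareDensity T5PoincareMeasure T5SU11Unimodular T5U11Unimodular T5U11Product
  T5SU11Fibration T5SU11FibrationHaar T5SU11FibrationCartan T5HaarCircle
open T5BergmanCoefficient T5BergmanPairing T5BergmanFourier T5BergmanParseval T5BergmanActStable
  T5BergmanMatrixCoeff T5BergmanSchur T5BergmanKTypeMatrix T5BergmanIntegrableCoeff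
  T5BergmanProjection T5BergmanDiscThreshold T5BergmanIntegrableSharp T5BergmanU11
  T5BergmanSchurGeneralU11 T5BergmanIntegrableKFinite T5BergmanCoefficientLp
open scoped Real ENNReal NNReal

/-! ### Continuity of the coefficients on `U(1,1)` -/

/-- `g ↦ ⟨π_k(g) f, h⟩_k` is continuous on `U(1,1)` for holomorphic `f, h ∈ A_k` (through the quotient
map `mulHom`: `⟨π_k(λ g) f, h⟩_k = λ^k ⟨π_k(g) f, h⟩_k`). -/
theorem continuous_matrixCoeffU_of_differentiableOn (k : ℕ) (hk : 2 ≤ k) (f : ℂ → ℂ)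
    (hf : DifferentiableOn ℂ f (ball 0 1))
    (hfint : IntegrableOn (fun w => ‖f w‖ ^ 2 * (1 - ‖w‖ ^ 2) ^ (k - 2)) (ball (0 : ℂ) 1))
    (h : ℂ → ℂ) (hh : DifferentiableOn ℂ h (ball 0 1))
    (hhint : IntegrableOn (fun w => ‖h w‖ ^ 2 * (1 - ‖w‖ ^ 2) ^ (k - 2)) (ball (0 : ℂ) 1)) :
    Continuous (matrixCoeffU k f h) := by
  rw [isQuotientMap_mulHom.continuous_iff]
  have e : (matrixCoeffU k f h ∘ mulHom) =
      fun p : Circle × SU11 => ((p.1 : ℂ)) ^ k * matrixCoeff k f h p.2 := by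
    ext p
    exact matrixCoeffU_mulHom k f h p.1 p.2
  rw [e]
  exact ((continuous_subtype_val.comp continuous_fst).pow k).mul
    ((continuous_matrixCoeff_of_differentiableOn k hk f hf hfint h hh hhint).comp continuous_snd)

/-- The integrability data of the lowest-weight vector `1 ∈ A_k`. -/
lemma integrableOn_lowest (k : ℕ) :
    IntegrableOn (fun w => ‖lowest w‖ ^ 2 * (1 - ‖w‖ ^ 2) ^ (k - 2)) (ball (0 : ℂ) 1) := by
  refine (integrableOn_monomial k 0).congr_fun (fun w _ => ?_) measurableSet_ball
  simp [lowest]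

variable [MeasurableSpace Circle] [BorelSpace Circle] [MeasurableSpace U11] [BorelSpace U11]

/-! ### The transfer principle `U(1,1) ↔ SU(1,1)` -/

/-- **Transfer**: a continuous `F : U(1,1) → E` with `F (λ g) = G g` for `λ ∈ Z`, `g ∈ SU(1,1)` is
integrable against a Haar measure `μ_U` of `U(1,1)` iff `G` is integrable against a Haar measure `μ_S`
of `SU(1,1)` (the product formula `map mulHom (haarCircle ⊗ μ_S) = c · μ_U` with `c > 0`, and the
probability factor `haarCircle`). -/
theorem integrable_iff_of_mulHom {E : Type*} [NormedAddCommGroup E] (μU : Measure U11)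
    [IsHaarMeasure μU] (μS : Measure SU11) [IsHaarMeasure μS] {F : U11 → E} (hF : Continuous F)
    {G : SU11 → E} (hFG : ∀ (lam : Circle) (g : SU11), F (mulHom (lam, g)) = G g) :
    Integrable F μU ↔ Integrable G μS := by
  set c := haarScalarFactor (map mulHom (haarCircle.prod μS)) μU with hc
  have hc0 : c ≠ 0 := (T5U11Product.haarScalarFactor_pos haarCircle μS μU).ne'
  have hmap : map mulHom (haarCircle.prod μS) = c • μU := map_mulHom_prod_eq_smul haarCircle μS μU
  have hmeas : AEStronglyMeasurable F (map mulHom (haarCircle.prod μS)) := hF.aestronglyMeasurable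
  have e : (F ∘ mulHom) = fun q : Circle × SU11 => G q.2 := by
    ext q
    exact hFG q.1 q.2
  constructor
  · intro h
    have h1 : Integrable F (map mulHom (haarCircle.prod μS)) := by
      rw [hmap]
      exact h.smul_measure ENNReal.coe_ne_top
    have h2 : Integrable (F ∘ mulHom) (haarCircle.prod μS) :=
      (integrable_map_measure hmeas continuous_mulHom.measurable.aemeasurable).mp h1
    rw [e] at h2
    exact h2.of_comp_snd (IsProbabilityMeasure.ne_zero haarCircle)
  · intro h
    have h2 : Integrable (F ∘ mulHom) (haarCircle.prod μS) := by
      rw [e]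
      exact h.comp_snd haarCircle
    have h1 : Integrable F (map mulHom (haarCircle.prod μS)) :=
      (integrable_map_measure hmeas continuous_mulHom.measurable.aemeasurable).mpr h2
    rw [hmap] at h1
    exact (integrable_smul_measure (ENNReal.coe_ne_zero.mpr hc0) ENNReal.coe_ne_top).mp h1

/-- `|⟨π_k(g) f, h⟩_k|^p` on `U(1,1)` and on `SU(1,1)`: `g ↦ ⟨π_k(g) f, h⟩_k ∈ L^p(U(1,1), μ_U)` iff
`∈ L^p(SU(1,1), μ_S)`, for holomorphic `f, h ∈ A_k` and real `p > 0`. -/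
theorem memLp_matrixCoeffU_iff (μU : Measure U11) [IsHaarMeasure μU] (μS : Measure SU11)
    [IsHaarMeasure μS] (k : ℕ) (hk : 2 ≤ k) (f : ℂ → ℂ) (hf : DifferentiableOn ℂ f (ball 0 1))
    (hfint : IntegrableOn (fun w => ‖f w‖ ^ 2 * (1 - ‖w‖ ^ 2) ^ (k - 2)) (ball (0 : ℂ) 1))
    (h : ℂ → ℂ) (hh : DifferentiableOn ℂ h (ball 0 1))
    (hhint : IntegrableOn (fun w => ‖h w‖ ^ 2 * (1 - ‖w‖ ^ 2) ^ (k - 2)) (ball (0 : ℂ) 1))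
    {p : ℝ} (hp : 0 < p) :
    MemLp (matrixCoeffU k f h) (ENNReal.ofReal p) μU ↔
      MemLp (matrixCoeff k f h) (ENNReal.ofReal p) μS := by
  have hU := continuous_matrixCoeffU_of_differentiableOn k hk f hf hfint h hh hhint
  have hS := continuous_matrixCoeff_of_differentiableOn k hk f hf hfint h hh hhint
  rw [memLp_ofReal_iff_integrable_norm_rpow hU.aestronglyMeasurable hp,
    memLp_ofReal_iff_integrable_norm_rpow hS.aestronglyMeasurable hp]
  refine integrable_iff_of_mulHom μU μS (hU.norm.rpow_const fun g => Or.inr hp.le)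
    fun lam g => ?_
  rw [norm_matrixCoeffU_mulHom' k f h lam g]

/-- The `L¹` form of the transfer for a coefficient. -/
theorem integrable_matrixCoeffU_iff (μU : Measure U11) [IsHaarMeasure μU] (μS : Measure SU11)
    [IsHaarMeasure μS] (k : ℕ) (hk : 2 ≤ k) (f : ℂ → ℂ) (hf : DifferentiableOn ℂ f (ball 0 1))
    (hfint : IntegrableOn (fun w => ‖f w‖ ^ 2 * (1 - ‖w‖ ^ 2) ^ (k - 2)) (ball (0 : ℂ) 1))
    (h : ℂ → ℂ) (hh : DifferentiableOn ℂ h (ball 0 1))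
    (hhint : IntegrableOn (fun w => ‖h w‖ ^ 2 * (1 - ‖w‖ ^ 2) ^ (k - 2)) (ball (0 : ℂ) 1)) :
    Integrable (matrixCoeffU k f h) μU ↔ Integrable (matrixCoeff k f h) μS := by
  have e := memLp_matrixCoeffU_iff μU μS k hk f hf hfint h hh hhint (p := 1) one_pos
  rwa [ENNReal.ofReal_one, memLp_one_iff_integrable, memLp_one_iff_integrable] at e

/-! ### The thresholds on `U(1,1)` -/

/-- **`π_k` is integrable on `H_j = U(1,1)` iff `k ≥ 3`**, read on the lowest-weight coefficient:
`g ↦ ⟨π_k(g) 1, 1⟩_k ∈ L¹(U(1,1), μ_U)` iff `k ≥ 3` (`k ≥ 2`, every Haar measure `μ_U`). -/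
theorem integrable_matrixCoeffU_lowest_lowest_iff (μU : Measure U11) [IsHaarMeasure μU] (k : ℕ)
    (hk : 2 ≤ k) : Integrable (matrixCoeffU k lowest lowest) μU ↔ 3 ≤ k := by
  rw [integrable_matrixCoeffU_iff μU (nu haarCircle) k hk lowest (differentiableOn_const 1)
    (integrableOn_lowest k) lowest (differentiableOn_const 1) (integrableOn_lowest k),
    integrable_matrixCoeff_lowest_lowest_iff (nu haarCircle) k hk]

/-- **The `L^p` threshold on `U(1,1)`**: `g ↦ ⟨π_k(g) 1, 1⟩_k ∈ L^p(U(1,1), μ_U)` iff `k p > 2`. -/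
theorem memLp_matrixCoeffU_lowest_lowest_iff (μU : Measure U11) [IsHaarMeasure μU] (k : ℕ)
    (hk : 2 ≤ k) {p : ℝ} (hp : 0 < p) :
    MemLp (matrixCoeffU k lowest lowest) (ENNReal.ofReal p) μU ↔ 2 < (k : ℝ) * p := by
  rw [memLp_matrixCoeffU_iff μU (nu haarCircle) k hk lowest (differentiableOn_const 1)
    (integrableOn_lowest k) lowest (differentiableOn_const 1) (integrableOn_lowest k) hp,
    memLp_matrixCoeff_lowest_lowest_iff (nu haarCircle) k hk hp]

/-- `π₂⁺` is not integrable on `U(1,1)` either. -/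
theorem not_integrable_matrixCoeffU_lowest_lowest_two (μU : Measure U11) [IsHaarMeasure μU] :
    ¬ Integrable (matrixCoeffU 2 lowest lowest) μU := by
  rw [integrable_matrixCoeffU_lowest_lowest_iff μU 2 le_rfl]
  omega

/-- **Every `K`-finite matrix coefficient of `π_k` is integrable on `U(1,1)` for `k ≥ 3`**: for
polynomials `S_N, T_M`, `g ↦ ⟨π_k(g) S_N, T_M⟩_k ∈ L¹(U(1,1), μ_U)`. -/
theorem integrable_matrixCoeffU_partialSum_partialSum (μU : Measure U11) [IsHaarMeasure μU] (k : ℕ)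
    (hk : 3 ≤ k) (a b : ℕ → ℂ) (N M : ℕ) :
    Integrable (matrixCoeffU k (partialSum a N) (partialSum b M)) μU := by
  have hk2 : 2 ≤ k := by omega
  rw [integrable_matrixCoeffU_iff μU (nu haarCircle) k hk2 _ (differentiable_partialSum a N).differentiableOn
    (integrableOn_partialSum k a N) _ (differentiable_partialSum b M).differentiableOn
    (integrableOn_partialSum k b M)]
  exact integrable_matrixCoeff_partialSum_partialSum (nu haarCircle) k hk a b N M

/-- **Every `K`-finite matrix coefficient of `π_k` lies in `L^p(U(1,1))` for `k p > 2`**. -/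
theorem memLp_matrixCoeffU_partialSum_partialSum (μU : Measure U11) [IsHaarMeasure μU] (k : ℕ)
    (hk : 2 ≤ k) (a b : ℕ → ℂ) (N M : ℕ) {p : ℝ} (hp : 0 < p) (hkp : 2 < (k : ℝ) * p) :
    MemLp (matrixCoeffU k (partialSum a N) (partialSum b M)) (ENNReal.ofReal p) μU := by
  rw [memLp_matrixCoeffU_iff μU (nu haarCircle) k hk _ (differentiable_partialSum a N).differentiableOn
    (integrableOn_partialSum k a N) _ (differentiable_partialSum b M).differentiableOn
    (integrableOn_partialSum k b M) hp]
  exact memLp_matrixCoeff_partialSum_partialSum (nu haarCircle) k hk a b N M hp hkp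

end Summit.Ventures.HodgeRepro2.T5BergmanIntegrableSharpU11
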